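import Mathlib
import Summits.KontsevichZagierPeriods.Zeta5Search.Families.SeatingGapReflect
import Summits.KontsevichZagierPeriods.Zeta5Search.Families.BasicGrowthClasses
import HarnessLib

/-!
# ζ(5) search — Families: the census leading coefficients `gapCT τ n` are CLASS INVARIANTS of the seating plan

HONEST FRAMING: systematic search; no irrationality claim unless certified.  Cell `pub-zeta5`, seat P2 g10 (Families
layer), 2026-08-23.  Identities between integers (coefficients of integer polynomials); nothing about any zeta value; no
record moves; no conjecture node is used.

The integer-level counterpart of P2 g4's `Families/BasicGrowthClasses` (growth constants are class functions): Brown's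
dihedral group `D_{2n} × D_{2n}` acting on printed seating plans ([Brown2016, Def. 3.1]; list-level action
`ConvergentClasses.act`, readings `ofResidues` / `ofSeating`) does not change cert-2 g11's diagonal gap constant terms
`SeatingGap.gapCT` (`Families/SeatingGapGrowth`; = the census leading coefficients of all `N = 8` classes by
`Families/CubicalChartLead*`).  The two POSITION generators re-index the edge product (`gapCT_shift_const`,
`gapCT_reverse_const`, this file); the two LABEL generators are `gapCT_add_const` (`Families/SeatingGapGauge`, gauge
independence) and `gapCT_const_sub` (`Families/SeatingGapReflect`).
* `gapCT_ofResidues_act`, **`gapCT_ofSeating_eq_of_equivalent`**: equivalent seating plans have the same `gapCT · n`, every `n`.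
Standard axioms only.
-/

namespace Summit.KontsevichZagierPeriods.Zeta5Search.Families.Cellular

namespace SeatingGap

open MvPolynomial Finset GapRegime
open Literature.NumberTheory.Irrationality.Brown2016
open Fin.NatCast Fin.CommRing

variable {ℓ : ℕ} (τ : Fin (ℓ + 3) → Fin (ℓ + 3))

/-- The factor of an edge only depends on its two endpoints (same orientation). -/
theorem edgeFactor_congr (σ σ' : Fin (ℓ + 3) → Fin (ℓ + 3)) (e e' : Fin (ℓ + 3)) (n : ℕ)
    (h1 : σ e = σ' e') (h2 : σ (e + 1) = σ' (e' + 1)) :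
    SpanHall.spanPoly (edgeSpan σ) e ^ finExp σ n e = SpanHall.spanPoly (edgeSpan σ') e' ^ finExp σ' n e' := by
  have hs : edgeSpan σ e = edgeSpan σ' e' := by
    ext w; simp only [edgeSpan, mem_filter, mem_univ, true_and, h1, h2]
  have hf : finExp σ n e = finExp σ' n e' := by simp only [finExp, h1, h2]
  rw [SpanHall.spanPoly, SpanHall.spanPoly, hs, hf]

/-- The factor of an edge only depends on its two endpoints (opposite orientation). -/
theorem edgeFactor_symm (σ σ' : Fin (ℓ + 3) → Fin (ℓ + 3)) (e e' : Fin (ℓ + 3)) (n : ℕ)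
    (h1 : σ e = σ' (e' + 1)) (h2 : σ (e + 1) = σ' e') :
    SpanHall.spanPoly (edgeSpan σ) e ^ finExp σ n e = SpanHall.spanPoly (edgeSpan σ') e' ^ finExp σ' n e' := by
  have hs : edgeSpan σ e = edgeSpan σ' e' := by
    ext w; simp only [edgeSpan, mem_filter, mem_univ, true_and, h1, h2, min_comm, max_comm]
  have hf : finExp σ n e = finExp σ' n e' := by simp only [finExp, h1, h2, and_comm]
  rw [SpanHall.spanPoly, SpanHall.spanPoly, hs, hf]

/-- **Position shift**: `gapCT (τ ∘ (· + r)) n = gapCT τ n`. -/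
theorem gapCT_shift_const (r : Fin (ℓ + 3)) (n : ℕ) : gapCT (fun i => τ (i + r)) n = gapCT τ n := by
  unfold gapCT gapPoly SpanHall.spanProd
  congr 1
  refine Fintype.prod_equiv (Equiv.addRight r) _ _ fun e => ?_
  exact edgeFactor_congr _ _ _ _ n (by simp) (by simp only [Equiv.coe_addRight]; rw [add_right_comm])

/-- **Position reversal**: `gapCT (τ ∘ (c − ·)) n = gapCT τ n`. -/
theorem gapCT_reverse_const (c : Fin (ℓ + 3)) (n : ℕ) : gapCT (fun i => τ (c - i)) n = gapCT τ n := by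
  unfold gapCT gapPoly SpanHall.spanProd
  congr 1
  refine Fintype.prod_equiv (Equiv.subLeft (c - 1)) _ _ fun e => ?_
  refine edgeFactor_symm _ _ _ _ n ?_ ?_ <;> simp only [Equiv.subLeft_apply]
  · congr 1; abel
  · congr 1; abel

/-- **Brown's symmetries preserve the census leading coefficients of the reading**: for a list `σ` of length `n` whose
reading is bijective and any element `(pr, r, vn, c)` of `D_{2n} × D_{2n}`, `gapCT (ofResidues (act n pr r vn c σ)) m
= gapCT (ofResidues σ) m`. -/
theorem gapCT_ofResidues_act {σ : List ℕ} (hσ : σ.length = ℓ + 3)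
    (hb : Function.Bijective (ofResidues (ℓ := ℓ) σ)) (pr : Bool) (r : ℕ) (vn : Bool) (c : ℕ) (m : ℕ) :
    gapCT (ofResidues (ℓ := ℓ) (act (ℓ + 3) pr r vn c σ)) m = gapCT (ofResidues (ℓ := ℓ) σ) m := by
  have hbs : Function.Bijective fun i => ofResidues (ℓ := ℓ) σ (i + (r : Fin (ℓ + 3))) :=
    hb.comp (Equiv.addRight (r : Fin (ℓ + 3))).bijective
  have hbr : Function.Bijective fun i =>
      ofResidues (ℓ := ℓ) σ (((((ℓ + 3 - 1 : ℕ)) : Fin (ℓ + 3)) - (r : Fin (ℓ + 3))) - i) :=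
    hb.comp (Equiv.subLeft ((((ℓ + 3 - 1 : ℕ)) : Fin (ℓ + 3)) - (r : Fin (ℓ + 3)))).bijective
  cases pr <;> cases vn
  · rw [ofResidues_act_ff hσ, gapCT_add_const _ hbs, gapCT_shift_const]
  · rw [ofResidues_act_ft hσ, gapCT_const_sub _ hbs, gapCT_shift_const]
  · rw [ofResidues_act_tf hσ, gapCT_add_const _ hbr, gapCT_reverse_const]
  · rw [ofResidues_act_tt hσ, gapCT_const_sub _ hbr, gapCT_reverse_const]

/-- The 1-based reading `ofSeating` and the 0-based reading `ofResidues` have the same `gapCT` (label rotation by `−1`). -/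
theorem gapCT_ofSeating_eq_gapCT_ofResidues {σ : List ℕ} (hσ : IsSeating (ℓ + 3) σ) (m : ℕ) :
    gapCT (ofSeating (ℓ := ℓ) σ) m = gapCT (ofResidues (ℓ := ℓ) σ) m := by
  have e : ofSeating (ℓ := ℓ) σ = fun i => ofResidues (ℓ := ℓ) σ i + (-1) := by
    funext i
    rw [ofSeating_eq_ofResidues_sub_one hσ, sub_eq_add_neg]
  rw [e]
  exact gapCT_add_const _ (bijective_ofResidues_of_isSeating hσ) (-1) m

/-- **The census leading coefficients are class invariants**: equivalent seating plans ([Brown2016, Def. 3.1]) have the same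
diagonal gap constant terms `gapCT · m` for every `m`. -/
theorem gapCT_ofSeating_eq_of_equivalent {σ σ' : List ℕ} (hσ : IsSeating (ℓ + 3) σ) (hσ' : IsSeating (ℓ + 3) σ')
    (h : Equivalent (ℓ + 3) σ σ') (m : ℕ) : gapCT (ofSeating (ℓ := ℓ) σ) m = gapCT (ofSeating (ℓ := ℓ) σ') m := by
  unfold Equivalent equiv at h
  simp only [List.any_eq_true, beq_iff_eq] at h
  obtain ⟨pr, -, r, -, vn, -, c, -, hact⟩ := h
  rw [gapCT_ofSeating_eq_gapCT_ofResidues hσ, gapCT_ofSeating_eq_gapCT_ofResidues hσ', ← ofResidues_map_mod σ', ← hact,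
    gapCT_ofResidues_act (length_of_isSeating hσ) (bijective_ofResidues_of_isSeating hσ)]

end SeatingGap

end Summit.KontsevichZagierPeriods.Zeta5Search.Families.Cellular
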